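import Literature.Barriers.RiemannHypothesis.JensenPolynomialsSqrt
import Literature.NumberTheory.LFunctions.XiTaylor
import Mathlib.Analysis.Complex.Liouville
import HarnessLib

/-!
# The scope-caveat witness of `JensenPolynomialsSqrt`, part 1: `M(w) = cosh √w + 2 cosh (√w/20)` and
# the reality of the zeros of `M'`

Companion to `Literature/Barriers/RiemannHypothesis/JensenPolynomialsSqrt.lean`, whose `scope_caveats` name
the example `f(z) = cos z + 2 cos (z/20)` («a witness with infinitely many real AND infinitely many non-real
zeros in a strip and `f' ∈ L–P` … is not formalised»).  This file and part 2 (`JensenPolynomialsSqrtMixed.lean`,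
the typed barrier `JensenPolynomialsSqrtMixed` and its proof) formalise it, after Farmer 2022 §4, in the
`√`-normalisation of that file: `M(w) = cosh √w + 2 cosh (√w / 20)` (`coshSqrtMix`; `M(-z²) = f(z)`).
Source: cell rh-split, seat rh-split-jen-bridge gen 3, scratch `HOME/rh-split-jen-bridge/SketchG3.lean` §7 (sha16
56ebb7b3456d0835, farm rc 0, standard axioms); filed by rh-split-typer-1 g3 on the cell lead's order (referee g2
content PASS 2026-08-27T01:19:41Z).

Contents: `coshSqrtMix` — values, conjugation symmetry, derivative (`deriv_coshSqrtMix`,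
`deriv_coshSqrtMix_sq_mul : 2u·M'(u²) = sinh u + sinh(u/20)/10`), Taylor data at `0`
(`iteratedDeriv_coshSqrtMix_zero`: real and positive), growth and `IsEntireOfOrderLtOne` for `M` and `M'`; and
**`im_eq_zero_of_deriv_coshSqrtMix_eq_zero`: every zero of `M'` is real** — a Hermite–Biehler modulus argument
with `E(u) = eᵘ + e^{u/20}/10` (`|E(-u)| < |E(u)|` for `Re u > 0`), no Rouché.  Also two generic lemmas in the
`taylorCoeffSeq` vocabulary used by part 2: the shift rule `jensenPoly_taylorCoeffSeq_succ` (`J^{d,n+1}(F) =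
J^{d,n}(F')`) and the Pólya–Schur converse for an arbitrary real entire `F`
(`im_eq_zero_of_forall_splits_taylorCoeffSeq`, discharging the power-series hypotheses of
`PolyaSchur.im_eq_zero_of_forall_splits_jensenPoly` by Taylor's theorem and Cauchy's estimate).

HONEST LABEL (cell rh-split): «SPLITTING SEARCH over kernel-typed RH-EQUIVALENCES; nothing here bears on
the truth of RH.»
-/

noncomputable section

open Complex Polynomial Filter Topology
open scoped Nat Real ComplexConjugate

namespace Literature.Barriers.RiemannHypothesis

open Literature.NumberTheory.LFunctions (jensenPoly exists_sq_eq iteratedDeriv_conj_of_conj)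
open Literature.Analysis.TotalPositivity (IsEntireOfOrderLtOne)

namespace CoshSqrtMix

/-- Rows `n ≥ 1`: `J^{d,n}(F) = J^{d,n-1}(F')` (shift = differentiation). [cite: CravenCsordas1989, §2] -/
theorem jensenPoly_taylorCoeffSeq_succ (F : ℂ → ℂ) (d m : ℕ) :
    jensenPoly (taylorCoeffSeq F) d (m + 1) =
      jensenPoly (fun k ↦ (iteratedDeriv k (deriv F) 0).re) d m := by
  ext j
  simp only [coeff_jensenPoly, taylorCoeffSeq]
  rw [← iteratedDeriv_succ', show m + 1 + j = m + j + 1 by ring]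


/-! ### Pólya–Schur converse in the `taylorCoeffSeq` vocabulary (general bookkeeping wrapper) -/

/-- For an entire `F`, real on the real axis (`F(z̄) = conj F(z)`), with `F 0 ≠ 0`: if every row-`0`
Jensen polynomial `J^{d,0}(F)` is hyperbolic then every zero of `F` is real. This is the tree's
`PolyaSchur.im_eq_zero_of_forall_splits_jensenPoly` (Hurwitz) with its power-series hypotheses discharged
by Taylor's theorem for entire functions and Cauchy's estimate (so it applies to ANY entire real `F`).
[cite: CravenCsordas1989, §1 (i)] -/
theorem im_eq_zero_of_forall_splits_taylorCoeffSeq {F : ℂ → ℂ} (hFd : Differentiable ℂ F)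
    (hreal : ∀ z, F (conj z) = conj (F z)) (h0 : F 0 ≠ 0)
    (hs : ∀ d : ℕ, (jensenPoly (taylorCoeffSeq F) d 0).Splits) {w : ℂ} (hw : F w = 0) :
    w.im = 0 := by
  -- the Taylor coefficients at `0` are real
  have hre : ∀ j, ((taylorCoeffSeq F j : ℝ) : ℂ) = iteratedDeriv j F 0 := fun j ↦ by
    rw [taylorCoeffSeq]
    have h := iteratedDeriv_conj_of_conj hreal j 0
    rw [map_zero] at h
    exact Complex.conj_eq_iff_re.1 h.symm
  -- Taylor series of an entire function
  have hF : ∀ z : ℂ, HasSum (fun j ↦ ((taylorCoeffSeq F j : ℝ) : ℂ) / (j ! : ℂ) * z ^ j) (F z) := by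
    intro z
    have h := Complex.hasSum_taylorSeries_of_entire hFd 0 z
    simp only [sub_zero, smul_eq_mul] at h
    have e : (fun j ↦ ((taylorCoeffSeq F j : ℝ) : ℂ) / (j ! : ℂ) * z ^ j) =
        fun n ↦ (n ! : ℂ)⁻¹ * (z ^ n * iteratedDeriv n F 0) := by
      funext j
      rw [hre j, div_eq_mul_inv]
      ring
    rw [e]
    exact h
  -- absolute convergence from Cauchy's estimate on the circle of radius `2R + 1`
  have hsum : ∀ R : ℝ, 0 ≤ R → Summable fun j ↦ |taylorCoeffSeq F j| / (j ! : ℝ) * R ^ j := by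
    intro R hR
    set ρ : ℝ := 2 * R + 1 with hρ
    have hρ0 : 0 < ρ := by positivity
    obtain ⟨C, hC⟩ := (isCompact_sphere (0 : ℂ) ρ).exists_bound_of_continuousOn
      hFd.continuous.continuousOn
    have hq : R / ρ < 1 := by rw [div_lt_one hρ0]; linarith
    have hq0 : 0 ≤ R / ρ := div_nonneg hR hρ0.le
    have hC0 : 0 ≤ C := by
      have hz : ((ρ : ℝ) : ℂ) ∈ Metric.sphere (0 : ℂ) ρ := by
        simp [Complex.norm_real, Real.norm_eq_abs, abs_of_pos hρ0]
      exact (norm_nonneg _).trans (hC _ hz)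
    refine Summable.of_nonneg_of_le (fun j ↦ by positivity) (fun j ↦ ?_)
      ((summable_geometric_of_lt_one hq0 hq).mul_left C)
    have hcau := Complex.norm_iteratedDeriv_le_of_forall_mem_sphere_norm_le j hρ0 hFd.diffContOnCl hC
    have hγ : |taylorCoeffSeq F j| ≤ (j ! : ℝ) * C / ρ ^ j := (Complex.abs_re_le_norm _).trans hcau
    have hj : (0 : ℝ) < j ! := by exact_mod_cast Nat.factorial_pos j
    have hγ' : |taylorCoeffSeq F j| / (j ! : ℝ) ≤ C / ρ ^ j := by
      rw [div_le_iff₀ hj]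
      calc |taylorCoeffSeq F j| ≤ (j ! : ℝ) * C / ρ ^ j := hγ
        _ = C / ρ ^ j * (j ! : ℝ) := by ring
    calc |taylorCoeffSeq F j| / (j ! : ℝ) * R ^ j ≤ C / ρ ^ j * R ^ j := by gcongr
      _ = C * (R / ρ) ^ j := by rw [div_pow]; ring
  exact Literature.Analysis.Complex.PolyaSchur.im_eq_zero_of_forall_splits_jensenPoly hsum hF hFd h0
    hs hw



/-- The caveat witness `M(w) = cosh √w + 2 cosh (√w/20)` (`(400)⁻¹ w = (√w/20)²`). [cite: Farmer2022, §4] -/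
def coshSqrtMix (w : ℂ) : ℂ := coshSqrt w + 2 * coshSqrt ((400 : ℂ)⁻¹ * w)

/-- `M(u²) = cosh u + 2 cosh (u/20)`. [cite: Farmer2022, §4] -/
theorem coshSqrtMix_sq (u : ℂ) : coshSqrtMix (u ^ 2) = Complex.cosh u + 2 * Complex.cosh (u / 20) := by
  rw [coshSqrtMix, show (400 : ℂ)⁻¹ * u ^ 2 = (u / 20) ^ 2 by ring, coshSqrt_sq, coshSqrt_sq]

/-- `M(0) = 3`. [cite: Farmer2022, §4] -/
theorem coshSqrtMix_zero : coshSqrtMix 0 = 3 := by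
  rw [coshSqrtMix, mul_zero, coshSqrt_zero]; norm_num

/-- `M` is entire. [cite: Farmer2022, §4] -/
theorem differentiable_coshSqrtMix : Differentiable ℂ coshSqrtMix := by
  refine differentiable_coshSqrt.add ((differentiable_coshSqrt.comp ?_).const_mul 2)
  exact differentiable_id.const_mul _

/-- `cosh √·` is real on the real axis: `cosh √(conj w) = conj (cosh √w)` (termwise conjugation of the
power series). [folklore] -/
private theorem coshSqrt_conj (w : ℂ) : coshSqrt (conj w) = conj (coshSqrt w) := by
  rw [coshSqrt_eq_tsum, coshSqrt_eq_tsum, Complex.conj_tsum]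
  refine tsum_congr fun k ↦ ?_
  rw [map_mul, map_pow]
  simp [coshSqrtCoeff]

/-- `M` is real on the real axis: `M(conj w) = conj (M w)`. [cite: Farmer2022, §4] -/
theorem coshSqrtMix_conj (w : ℂ) : coshSqrtMix (conj w) = conj (coshSqrtMix w) := by
  rw [coshSqrtMix, coshSqrtMix, map_add, map_mul, ← coshSqrt_conj, ← coshSqrt_conj, map_mul, map_inv₀,
    map_ofNat, map_ofNat]

/-- The derivative of `M` (chain rule on `cosh √(w/400)`). [folklore] -/
private theorem hasDerivAt_coshSqrtMix (w : ℂ) :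
    HasDerivAt coshSqrtMix (deriv coshSqrt w + 2 * (deriv coshSqrt ((400 : ℂ)⁻¹ * w) * (400 : ℂ)⁻¹)) w := by
  have h1 : HasDerivAt coshSqrt (deriv coshSqrt w) w := (differentiable_coshSqrt w).hasDerivAt
  have h2 : HasDerivAt (fun v : ℂ ↦ (400 : ℂ)⁻¹ * v) ((400 : ℂ)⁻¹ * 1) w := (hasDerivAt_id w).const_mul _
  have h3 : HasDerivAt (fun v : ℂ ↦ coshSqrt ((400 : ℂ)⁻¹ * v))
      (deriv coshSqrt ((400 : ℂ)⁻¹ * w) * ((400 : ℂ)⁻¹ * 1)) w :=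
    (differentiable_coshSqrt _).hasDerivAt.comp w h2
  rw [mul_one] at h3
  exact h1.add (h3.const_mul 2)

/-- `M'(w) = (cosh √·)'(w) + (1/200)·(cosh √·)'(w/400)`. [folklore] -/
private theorem deriv_coshSqrtMix (w : ℂ) :
    deriv coshSqrtMix w = deriv coshSqrt w + (200 : ℂ)⁻¹ * deriv coshSqrt ((400 : ℂ)⁻¹ * w) := by
  rw [(hasDerivAt_coshSqrtMix w).deriv]; ring

/-- `2u · M'(u²) = sinh u + sinh (u/20) / 10`. [folklore] -/
private theorem deriv_coshSqrtMix_sq_mul (u : ℂ) :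
    deriv coshSqrtMix (u ^ 2) * (2 * u) = Complex.sinh u + Complex.sinh (u / 20) / 10 := by
  rw [deriv_coshSqrtMix, add_mul, deriv_coshSqrt_sq_mul,
    show (400 : ℂ)⁻¹ * u ^ 2 = (u / 20) ^ 2 by ring,
    show (200 : ℂ)⁻¹ * deriv coshSqrt ((u / 20) ^ 2) * (2 * u) =
      (10 : ℂ)⁻¹ * (deriv coshSqrt ((u / 20) ^ 2) * (2 * (u / 20))) by ring,
    deriv_coshSqrt_sq_mul]
  ring

/-- `M'(0) = 201/400`. [cite: Farmer2022, §4] -/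
theorem deriv_coshSqrtMix_zero : deriv coshSqrtMix 0 = ((201 / 400 : ℝ) : ℂ) := by
  rw [deriv_coshSqrtMix, mul_zero, deriv_coshSqrt_zero]; push_cast; ring

/-- `M'` is entire. [folklore] -/
private theorem differentiable_deriv_coshSqrtMix : Differentiable ℂ (deriv coshSqrtMix) := fun z ↦
  ((differentiable_coshSqrtMix.analyticAt z).deriv).differentiableAt

/-- Taylor coefficients: `M⁽ᵏ⁾(0) = (k!/(2k)!) · (1 + 2·400⁻ᵏ)`. [folklore] -/
private theorem iteratedDeriv_coshSqrtMix_zero (k : ℕ) :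
    iteratedDeriv k coshSqrtMix 0 =
      ((((k ! : ℝ) / ((2 * k)! : ℕ)) * (1 + 2 * (400 : ℝ)⁻¹ ^ k) : ℝ) : ℂ) := by
  have hcd : ContDiff ℂ k coshSqrt := differentiable_coshSqrt.contDiff
  have hsc : ContDiff ℂ k (fun w : ℂ ↦ coshSqrt ((400 : ℂ)⁻¹ * w)) :=
    (differentiable_coshSqrt.comp (differentiable_id.const_mul _)).contDiff
  have hsc2 : ContDiff ℂ k (fun w : ℂ ↦ 2 * coshSqrt ((400 : ℂ)⁻¹ * w)) :=
    ((differentiable_coshSqrt.comp (differentiable_id.const_mul _)).const_mul 2).contDiff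
  have e : coshSqrtMix = coshSqrt + fun w : ℂ ↦ 2 * coshSqrt ((400 : ℂ)⁻¹ * w) := rfl
  rw [e, iteratedDeriv_add hcd.contDiffAt hsc2.contDiffAt, iteratedDeriv_const_mul _ hsc.contDiffAt,
    iteratedDeriv_comp_const_mul hcd]
  beta_reduce
  rw [mul_zero, iteratedDeriv_coshSqrt_zero, div_eq_mul_inv]
  push_cast
  ring

/-- The Taylor data of `M` is real. [cite: Farmer2022, §4] -/
theorem im_iteratedDeriv_coshSqrtMix (k : ℕ) : (iteratedDeriv k coshSqrtMix 0).im = 0 := by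
  rw [iteratedDeriv_coshSqrtMix_zero, Complex.ofReal_im]

/-- `taylorCoeffSeq M k = k!·(1 + 2·400⁻ᵏ)/(2k)!`. [folklore] -/
private theorem taylorCoeffSeq_coshSqrtMix (k : ℕ) :
    taylorCoeffSeq coshSqrtMix k = ((k ! : ℝ) / ((2 * k)! : ℕ)) * (1 + 2 * (400 : ℝ)⁻¹ ^ k) := by
  rw [taylorCoeffSeq, iteratedDeriv_coshSqrtMix_zero, Complex.ofReal_re]

/-- The Taylor coefficients of `M` are positive. [cite: Farmer2022, §4] -/
theorem taylorCoeffSeq_coshSqrtMix_pos (k : ℕ) : 0 < taylorCoeffSeq coshSqrtMix k := by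
  rw [taylorCoeffSeq_coshSqrtMix]; positivity

/-- Growth: `‖M w‖ ≤ 3 exp (‖w‖^{1/2})` (order `1/2`). [folklore] -/
private theorem norm_coshSqrtMix_le (w : ℂ) : ‖coshSqrtMix w‖ ≤ 3 * Real.exp (‖w‖ ^ (1 / 2 : ℝ)) := by
  have h1 := norm_coshSqrt_le w
  have h2 : ‖coshSqrt ((400 : ℂ)⁻¹ * w)‖ ≤ Real.exp (‖w‖ ^ (1 / 2 : ℝ)) := by
    refine (norm_coshSqrt_le _).trans ?_
    gcongr
    rw [norm_mul, norm_inv, Complex.norm_ofNat]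
    have := norm_nonneg w
    nlinarith
  calc ‖coshSqrtMix w‖ ≤ ‖coshSqrt w‖ + ‖2 * coshSqrt ((400 : ℂ)⁻¹ * w)‖ := norm_add_le _ _
    _ = ‖coshSqrt w‖ + 2 * ‖coshSqrt ((400 : ℂ)⁻¹ * w)‖ := by rw [norm_mul, Complex.norm_two]
    _ ≤ Real.exp (‖w‖ ^ (1 / 2 : ℝ)) + 2 * Real.exp (‖w‖ ^ (1 / 2 : ℝ)) := by gcongr
    _ = 3 * Real.exp (‖w‖ ^ (1 / 2 : ℝ)) := by ring

/-- `M` is entire of order `< 1`. [cite: Farmer2022, §4] -/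
theorem isEntireOfOrderLtOne_coshSqrtMix : IsEntireOfOrderLtOne coshSqrtMix :=
  ⟨differentiable_coshSqrtMix, 1 / 2, 3, by norm_num, norm_coshSqrtMix_le⟩

/-- Growth of `M'`: `‖M' w‖ ≤ 2e · exp (‖w‖^{1/2})` (from the tree's Cauchy estimate for `coshSqrt'`).
[folklore] -/
private theorem norm_deriv_coshSqrtMix_le (w : ℂ) :
    ‖deriv coshSqrtMix w‖ ≤ 2 * Real.exp 1 * Real.exp (‖w‖ ^ (1 / 2 : ℝ)) := by
  have h1 := norm_deriv_coshSqrt_le w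
  have h2 : ‖deriv coshSqrt ((400 : ℂ)⁻¹ * w)‖ ≤ Real.exp 1 * Real.exp (‖w‖ ^ (1 / 2 : ℝ)) := by
    refine (norm_deriv_coshSqrt_le _).trans ?_
    gcongr
    rw [norm_mul, norm_inv, Complex.norm_ofNat]
    have := norm_nonneg w
    nlinarith
  have h0 : 0 ≤ Real.exp 1 * Real.exp (‖w‖ ^ (1 / 2 : ℝ)) := by positivity
  calc ‖deriv coshSqrtMix w‖
      ≤ ‖deriv coshSqrt w‖ + ‖(200 : ℂ)⁻¹ * deriv coshSqrt ((400 : ℂ)⁻¹ * w)‖ := by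
        rw [deriv_coshSqrtMix]; exact norm_add_le _ _
    _ = ‖deriv coshSqrt w‖ + 200⁻¹ * ‖deriv coshSqrt ((400 : ℂ)⁻¹ * w)‖ := by
        rw [norm_mul, norm_inv, Complex.norm_ofNat]
    _ ≤ Real.exp 1 * Real.exp (‖w‖ ^ (1 / 2 : ℝ)) + 200⁻¹ * (Real.exp 1 * Real.exp (‖w‖ ^ (1 / 2 : ℝ))) := by
        gcongr
    _ ≤ 2 * Real.exp 1 * Real.exp (‖w‖ ^ (1 / 2 : ℝ)) := by nlinarith

/-- `M'` is entire of order `< 1`. [cite: Farmer2022, §4] -/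
theorem isEntireOfOrderLtOne_deriv_coshSqrtMix : IsEntireOfOrderLtOne (deriv coshSqrtMix) :=
  ⟨differentiable_deriv_coshSqrtMix, 1 / 2, 2 * Real.exp 1, by norm_num, norm_deriv_coshSqrtMix_le⟩

/-! ### The zeros of `M'` are real (Hermite–Biehler modulus argument) -/

/-- `E(u) = eᵘ + e^{u/20}/10`, so that `2·(sinh u + sinh(u/20)/10) = E(u) − E(−u)`. [folklore] -/
private def Emix (u : ℂ) : ℂ := Complex.exp u + Complex.exp (u / 20) / 10

/-- `E(u) - E(-u) = 2 (sinh u + sinh(u/20)/10)`. [folklore] -/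
private theorem Emix_sub_Emix_neg (u : ℂ) :
    Emix u - Emix (-u) = 2 * (Complex.sinh u + Complex.sinh (u / 20) / 10) := by
  simp only [Emix]
  rw [neg_div, mul_add, ← mul_div_assoc, Complex.two_sinh, Complex.two_sinh]
  ring

/-- `|E(u)|² = e^{2x} + e^{x/10}/100 + e^{21x/20} cos(19y/20)/5` (`u = x + iy`). [folklore] -/
private theorem normSq_Emix (u : ℂ) :
    Complex.normSq (Emix u) = Real.exp (2 * u.re) + Real.exp (u.re / 10) / 100 +
      Real.exp (21 * u.re / 20) * Real.cos (19 * u.im / 20) / 5 := by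
  rw [Emix, Complex.normSq_add]
  have h1 : Complex.normSq (Complex.exp u) = Real.exp (2 * u.re) := by
    rw [Complex.normSq_eq_norm_sq, Complex.norm_exp, sq, ← Real.exp_add]; ring_nf
  have h2 : Complex.normSq (Complex.exp (u / 20) / 10) = Real.exp (u.re / 10) / 100 := by
    rw [Complex.normSq_eq_norm_sq, norm_div, Complex.norm_ofNat, Complex.norm_exp, div_pow, sq,
      ← Real.exp_add, Complex.div_ofNat_re]
    ring_nf
  have h3 : Complex.exp u * conj (Complex.exp (u / 20) / 10) = Complex.exp (u + conj u / 20) / 10 := by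
    rw [map_div₀, ← Complex.exp_conj, map_div₀, map_ofNat, map_ofNat, mul_div_assoc', ← Complex.exp_add]
  have h4 : (Complex.exp (u + conj u / 20) / 10).re =
      Real.exp (21 * u.re / 20) * Real.cos (19 * u.im / 20) / 10 := by
    rw [Complex.div_ofNat_re, Complex.exp_re]
    have e1 : (u + conj u / 20).re = 21 * u.re / 20 := by
      rw [Complex.add_re, Complex.div_ofNat_re, Complex.conj_re]; ring
    have e2 : (u + conj u / 20).im = 19 * u.im / 20 := by
      rw [Complex.add_im, Complex.div_ofNat_im, Complex.conj_im]; ring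
    rw [e1, e2]
  rw [h1, h2, h3, h4]
  ring

/-- The modulus inequality: `|E(−u)| < |E(u)|` when `Re u > 0`. [folklore] -/
private theorem normSq_Emix_neg_lt {u : ℂ} (hx : 0 < u.re) :
    Complex.normSq (Emix (-u)) < Complex.normSq (Emix u) := by
  rw [normSq_Emix, normSq_Emix, Complex.neg_re, Complex.neg_im]
  have a1 : Real.exp (2 * -u.re) = Real.exp (2 * u.re) - 2 * Real.sinh (2 * u.re) := by
    rw [Real.sinh_eq, show (2 : ℝ) * -u.re = -(2 * u.re) by ring]; ring
  have a2 : Real.exp (-u.re / 10) = Real.exp (u.re / 10) - 2 * Real.sinh (u.re / 10) := by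
    rw [Real.sinh_eq, show -u.re / 10 = -(u.re / 10) by ring]; ring
  have a3 : Real.exp (21 * -u.re / 20) = Real.exp (21 * u.re / 20) - 2 * Real.sinh (21 * u.re / 20) := by
    rw [Real.sinh_eq, show (21 : ℝ) * -u.re / 20 = -(21 * u.re / 20) by ring]; ring
  have a4 : Real.cos (19 * -u.im / 20) = Real.cos (19 * u.im / 20) := by
    rw [← Real.cos_neg]; exact congrArg Real.cos (by ring)
  rw [a1, a2, a3, a4]
  have s1 : 0 < Real.sinh (2 * u.re) := Real.sinh_pos_iff.2 (by linarith)
  have s2 : 0 < Real.sinh (u.re / 10) := Real.sinh_pos_iff.2 (by linarith)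
  have s3 : 0 < Real.sinh (21 * u.re / 20) := Real.sinh_pos_iff.2 (by linarith)
  have s31 : Real.sinh (21 * u.re / 20) < Real.sinh (2 * u.re) := Real.sinh_lt_sinh.2 (by linarith)
  have hc : -1 ≤ Real.cos (19 * u.im / 20) := Real.neg_one_le_cos _
  have hcs : -1 * Real.sinh (21 * u.re / 20) ≤ Real.cos (19 * u.im / 20) * Real.sinh (21 * u.re / 20) :=
    mul_le_mul_of_nonneg_right hc s3.le
  nlinarith

/-- If `sinh u + sinh(u/20)/10 = 0` then `Re u = 0`. [folklore] -/
private theorem re_eq_zero_of_sinh_add_eq_zero {u : ℂ} (h : Complex.sinh u + Complex.sinh (u / 20) / 10 = 0) :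
    u.re = 0 := by
  have hE : Emix u = Emix (-u) := by
    rw [← sub_eq_zero, Emix_sub_Emix_neg, h, mul_zero]
  rcases lt_trichotomy u.re 0 with hx | hx | hx
  · have h1 := normSq_Emix_neg_lt (u := -u) (by rw [Complex.neg_re]; linarith)
    rw [neg_neg, hE] at h1
    exact absurd h1 (lt_irrefl _)
  · exact hx
  · have h1 := normSq_Emix_neg_lt hx
    rw [hE] at h1
    exact absurd h1 (lt_irrefl _)

/-- **Every zero of `M'` is real** (indeed `≤ 0`): `M'` is a genus-zero Laguerre–Pólya function.
[cite: Farmer2022, §4] -/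
theorem im_eq_zero_of_deriv_coshSqrtMix_eq_zero {w : ℂ} (hw : deriv coshSqrtMix w = 0) : w.im = 0 := by
  obtain ⟨u, rfl⟩ := exists_sq_eq w
  have h : Complex.sinh u + Complex.sinh (u / 20) / 10 = 0 := by
    rw [← deriv_coshSqrtMix_sq_mul, hw, zero_mul]
  have hre := re_eq_zero_of_sinh_add_eq_zero h
  rw [sq, Complex.mul_im, hre, zero_mul, mul_zero, add_zero]

end CoshSqrtMix

end Literature.Barriers.RiemannHypothesis

end
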